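import Mathlib
import Literature.Probability.LatticeModels.TemperleyLiebLinkPatterns
import Literature.Probability.LatticeModels.TemperleyLiebBaxterization
import Literature.Probability.Percolation.DiagonalStripPlanarity
import Literature.Probability.Percolation.DiagonalStripLumping
import HarnessLib

/-!
# The connectivity (cluster) basis of the Temperley–Lieb algebra at loop weight `1`

Topic `Literature/Probability/LatticeModels`. In Ikhlef–Ponsaing (J. Stat. Phys. 149 (2012),
arXiv:1202.5476) the loop weight is `n = -(q + q⁻¹) = 1` (`q = e^{2iπ/3}`, §2.4, §3.1): the
Temperley–Lieb generators `e_j` act on link patterns by `0/1` matrices. By Baxter's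
cluster–loop correspondence (§2.1) the same representation can be written on CLUSTER CONNECTIVITIES
of the boundary sites — the language in which the percolation dictionary of
`Literature/Probability/Percolation/DiagonalStrip*.lean` lives (non-crossing equivalence relations
on the `m + 1` sites of an even column, the wall being the class of the bottom site). This file
builds that representation:

* `SiteRel n` (Bool relations on `Fin n`), `SiteRel.IsNCEquiv` (non-crossing equivalence
  relation), `SiteRel.join a b` (merge the classes of `a, b`: the generator across the DUAL site
  between two consecutive sites) and `SiteRel.isolate a` (make `a` a singleton: the generator
  across the site `a`); both preserve `IsNCEquiv` (`join` for consecutive sites, via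
  `not_hasCrossing_mergeRel` of `DiagonalStripPlanarity.lean`);
* the Temperley–Lieb relations at `n = 1` as identities of maps: `join_join`, `isolate_isolate`
  (`e² = e`), `isolate_join_isolate`, `join_isolate_join` (`e_k e_{k±1} e_k = e_k`), `join_join_comm`,
  `isolate_isolate_comm`, `isolate_join_comm` (far commutation);
* `NCState n` (the finite state space), the generator maps `tlConnFun m k` (`k : Fin (2m)`:
  `k = 2b ↦ join b (b+1)`, `k = 2b+1 ↦ isolate (b+1)`; generator `e_{k+1}` of `TL_{2m+1}` in IP12's
  numbering, strands `k+1, k+2`), their linearisations `tlConn K m k` on `NCState (m+1) →₀ K`, and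
  **`isTemperleyLiebFamily_tlConn`** — they form a Temperley–Lieb family with `δ = 1`
  (`IsTemperleyLiebFamily` of `TemperleyLiebLinkPatterns.lean`).

With `TemperleyLiebBaxterization.lean` this gives the Yang–Baxter and unitarity relations of
IP12's `Ř_j(w)` (Lemma 3.1) on this representation for any `q` with `q² + q + 1 = 0`.

## References

* Y. Ikhlef, A. K. Ponsaing, J. Stat. Phys. 149 (2012) 10–36, arXiv:1202.5476, §2.1, §3.1.
  [IkhlefPonsaing2012]
* P. A. Pearce, V. Rittenberg, J. de Gier, B. Nienhuis, J. Phys. A 35 (2002) L661 (TL relations).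
  [PearceRittenbergDeGierNienhuis2002]
-/

namespace Literature.Probability.LatticeModels.TemperleyLieb

open Literature.Probability.Percolation

variable {n : ℕ}

/-- Bool-valued relations on the `n` boundary sites. [folklore] -/
abbrev SiteRel (n : ℕ) := Fin n → Fin n → Bool

namespace SiteRel

/-- **Non-crossing equivalence relations** (= non-crossing partitions of the sites: the cluster
connectivities of a planar model; counted by Catalan numbers). [cite: IkhlefPonsaing2012, §3.1] -/
structure IsNCEquiv (r : SiteRel n) : Prop where
  refl : ∀ i, r i i = true
  symm : ∀ i j, r i j = true → r j i = true
  trans : ∀ i j k, r i j = true → r j k = true → r i k = true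
  noncross : ∀ i j k l, i < j → j < k → k < l → r i k = true → r j l = true → r i j = true

/-- Unfolding of `IsNCEquiv`. [folklore] -/
theorem isNCEquiv_iff (r : SiteRel n) : r.IsNCEquiv ↔
    (∀ i, r i i = true) ∧ (∀ i j, r i j = true → r j i = true) ∧
      (∀ i j k, r i j = true → r j k = true → r i k = true) ∧
        (∀ i j k l, i < j → j < k → k < l → r i k = true → r j l = true → r i j = true) :=
  ⟨fun h => ⟨h.refl, h.symm, h.trans, h.noncross⟩, fun h => ⟨h.1, h.2.1, h.2.2.1, h.2.2.2⟩⟩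

/-- Being a non-crossing equivalence is decidable. [folklore] -/
instance (r : SiteRel n) : Decidable r.IsNCEquiv :=
  decidable_of_iff _ (isNCEquiv_iff r).symm

/-- The equivalence relation (in `Prop`) of a state. [folklore] -/
theorem IsNCEquiv.equivalence {r : SiteRel n} (hr : r.IsNCEquiv) :
    Equivalence fun i j => r i j = true :=
  ⟨hr.refl, fun {i j} h => hr.symm i j h, fun {i j k} h h' => hr.trans i j k h h'⟩

/-- **Join** the classes of the sites `a` and `b` (the TL generator across the dual site between two
consecutive sites, at loop weight `1`). [cite: IkhlefPonsaing2012, §3.1] -/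
def join (r : SiteRel n) (a b : Fin n) : SiteRel n :=
  fun i j => r i j || (r i a && r b j) || (r i b && r a j)

/-- **Isolate** the site `a` (the TL generator across the site `a`, at loop weight `1`: `a` is
cut off its cluster). [cite: IkhlefPonsaing2012, §3.1] -/
def isolate (r : SiteRel n) (a : Fin n) : SiteRel n :=
  fun i j => decide (i = j) || (!decide (i = a) && !decide (j = a) && r i j)

/-- Unfolding of `join`. [folklore] -/
theorem join_eq_true_iff (r : SiteRel n) (a b i j : Fin n) :
    r.join a b i j = true ↔
      r i j = true ∨ (r i a = true ∧ r b j = true) ∨ (r i b = true ∧ r a j = true) := by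
  simp only [join, Bool.or_eq_true, Bool.and_eq_true, or_assoc]

/-- `join` is `mergeRel` of `DiagonalStripPlanarity.lean`. [folklore] -/
theorem join_eq_true_iff_mergeRel (r : SiteRel n) (a b i j : Fin n) :
    r.join a b i j = true ↔ mergeRel (fun i j => r i j = true) a b i j := by
  rw [join_eq_true_iff]; rfl

/-- Unfolding of `isolate`. [folklore] -/
theorem isolate_eq_true_iff (r : SiteRel n) (a i j : Fin n) :
    r.isolate a i j = true ↔ i = j ∨ (i ≠ a ∧ j ≠ a ∧ r i j = true) := by
  simp only [isolate, Bool.or_eq_true, decide_eq_true_eq, Bool.and_eq_true, Bool.not_eq_true',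
    decide_eq_false_iff_not, and_assoc]

/-- Joining consecutive sites preserves non-crossing equivalence relations. [folklore] -/
theorem IsNCEquiv.join {r : SiteRel n} (hr : r.IsNCEquiv) (a b : Fin n) (hab : (b : ℕ) = a + 1) :
    (r.join a b).IsNCEquiv := by
  have hS := hr.equivalence
  have hM := mergeRel_equivalence hS a b
  have hnc : ¬ HasCrossing (fun i : Fin n => (i : ℤ)) (fun i j => r i j = true) := by
    rintro ⟨p, q, r', s, h1, h2, h3, hpr, hqs, hpq⟩
    dsimp only at h1 h2 h3
    exact hpq (hr.noncross p q r' s (by exact_mod_cast h1) (by exact_mod_cast h2)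
      (by exact_mod_cast h3) hpr hqs)
  have hM' := not_hasCrossing_mergeRel hS (fun i j h => Fin.ext (by exact_mod_cast h)) hnc
    (a := a) (a' := b) (by simp [hab])
  refine ⟨fun i => ?_, fun i j h => ?_, fun i j k h h' => ?_, fun i j k l hij hjk hkl hik hjl => ?_⟩
  · rw [join_eq_true_iff_mergeRel]; exact hM.refl i
  · rw [join_eq_true_iff_mergeRel] at h ⊢; exact hM.symm h
  · rw [join_eq_true_iff_mergeRel] at h h' ⊢; exact hM.trans h h'
  · rw [join_eq_true_iff_mergeRel] at hik hjl ⊢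
    exact rel_of_not_hasCrossing hM' (by exact_mod_cast hij) (by exact_mod_cast hjk)
      (by exact_mod_cast hkl) hik hjl

/-- Isolating a site preserves non-crossing equivalence relations. [folklore] -/
theorem IsNCEquiv.isolate {r : SiteRel n} (hr : r.IsNCEquiv) (a : Fin n) : (r.isolate a).IsNCEquiv := by
  refine ⟨fun i => ?_, fun i j h => ?_, fun i j k h h' => ?_, fun i j k l hij hjk hkl hik hjl => ?_⟩
  · rw [isolate_eq_true_iff]; exact Or.inl rfl
  · rw [isolate_eq_true_iff] at h ⊢
    rcases h with rfl | ⟨hi, hj, h⟩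
    · exact Or.inl rfl
    · exact Or.inr ⟨hj, hi, hr.symm _ _ h⟩
  · rw [isolate_eq_true_iff] at h h' ⊢
    rcases h with rfl | ⟨hi, hj, h⟩
    · exact h'
    · rcases h' with rfl | ⟨-, hk, h'⟩
      · exact Or.inr ⟨hi, hj, h⟩
      · exact Or.inr ⟨hi, hk, hr.trans _ _ _ h h'⟩
  · rw [isolate_eq_true_iff] at hik hjl ⊢
    rcases hik with hik | ⟨hi, hk, hik⟩
    · exact absurd (hik ▸ hij.trans hjk) (lt_irrefl _)
    · rcases hjl with hjl | ⟨hj, hl, hjl⟩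
      · exact absurd (hjl ▸ hjk.trans hkl) (lt_irrefl _)
      · exact Or.inr ⟨hi, hj, hr.noncross i j k l hij hjk hkl hik hjl⟩

/-! ### The Temperley–Lieb relations at loop weight `1`, as identities of maps -/

/-- `e² = e` for a join: joining already-joined sites does nothing. [cite: IkhlefPonsaing2012, §3.1] -/
theorem join_join {r : SiteRel n} (hr : r.IsNCEquiv) (a b : Fin n) :
    (r.join a b).join a b = r.join a b := by
  have hS := hr.equivalence
  have hM := mergeRel_equivalence hS a b
  have hab : mergeRel (fun i j => r i j = true) a b a b := mergeRel_self hS a b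
  funext i j
  rw [Bool.eq_iff_iff, join_eq_true_iff_mergeRel, join_eq_true_iff_mergeRel]
  have : (fun i j => r.join a b i j = true) = mergeRel (fun i j => r i j = true) a b := by
    funext i j; exact propext (join_eq_true_iff_mergeRel r a b i j)
  rw [this, mergeRel_eq_of_rel hM hab]

/-- `e² = e` for an isolation. [cite: IkhlefPonsaing2012, §3.1] -/
theorem isolate_isolate (r : SiteRel n) (a : Fin n) : (r.isolate a).isolate a = r.isolate a := by
  funext i j
  rw [Bool.eq_iff_iff]
  simp only [isolate_eq_true_iff]
  tauto

/-- `e_k e_{k±1} e_k = e_k` (isolate / join / isolate): for `c ∈ {a, b}`,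
`isolate c ∘ join a b ∘ isolate c = isolate c`. [cite: IkhlefPonsaing2012, §3.1] -/
theorem isolate_join_isolate (r : SiteRel n) {a b c : Fin n} (hc : c = a ∨ c = b) :
    ((r.isolate c).join a b).isolate c = r.isolate c := by
  funext i j
  rw [Bool.eq_iff_iff]
  simp only [isolate_eq_true_iff, join_eq_true_iff]
  constructor
  · rintro (h | ⟨hi, hj, h⟩)
    · exact Or.inl h
    · rcases h with (h | ⟨-, -, h⟩) | ⟨hia, hbj⟩ | ⟨hib, haj⟩
      · exact Or.inl h
      · exact Or.inr ⟨hi, hj, h⟩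
      · rcases hc with rfl | rfl
        · rcases hia with rfl | ⟨-, h, -⟩
          · exact absurd rfl hi
          · exact absurd rfl h
        · rcases hbj with rfl | ⟨h, -, -⟩
          · exact absurd rfl hj
          · exact absurd rfl h
      · rcases hc with rfl | rfl
        · rcases haj with rfl | ⟨h, -, -⟩
          · exact absurd rfl hj
          · exact absurd rfl h
        · rcases hib with rfl | ⟨-, h, -⟩
          · exact absurd rfl hi
          · exact absurd rfl h
  · rintro (h | ⟨hi, hj, h⟩)
    · exact Or.inl h
    · exact Or.inr ⟨hi, hj, Or.inl (Or.inr ⟨hi, hj, h⟩)⟩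

/-- `join` is symmetric in the two sites. [folklore] -/
theorem join_comm (r : SiteRel n) (a b : Fin n) : r.join a b = r.join b a := by
  funext i j
  rw [Bool.eq_iff_iff]
  simp only [join_eq_true_iff]
  tauto

/-- `e_k e_{k±1} e_k = e_k` (join / isolate / join), isolating the first site:
`join a b ∘ isolate a ∘ join a b = join a b` (`a ≠ b`). [cite: IkhlefPonsaing2012, §3.1] -/
theorem join_isolate_left_join {r : SiteRel n} (hr : r.IsNCEquiv) {a b : Fin n} (hab : a ≠ b) :
    ((r.join a b).isolate a).join a b = r.join a b := by
  have hS := hr.equivalence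
  have hM := mergeRel_equivalence hS a b
  set J := r.join a b with hJ
  have hJiff : ∀ i j, J i j = true ↔ mergeRel (fun i j => r i j = true) a b i j :=
    fun i j => join_eq_true_iff_mergeRel r a b i j
  have Jab : J a b = true := (hJiff a b).2 (mergeRel_self hS a b)
  have Jrefl : ∀ i, J i i = true := fun i => (hJiff i i).2 (hM.refl i)
  have Jsymm : ∀ {i j}, J i j = true → J j i = true := fun h => (hJiff _ _).2 (hM.symm ((hJiff _ _).1 h))
  have Jtrans : ∀ {i j k}, J i j = true → J j k = true → J i k = true :=
    fun h h' => (hJiff _ _).2 (hM.trans ((hJiff _ _).1 h) ((hJiff _ _).1 h'))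
  funext i j
  rw [Bool.eq_iff_iff]
  simp only [isolate_eq_true_iff, join_eq_true_iff]
  constructor
  · rintro ((rfl | ⟨-, -, h⟩) | ⟨hia, hbj⟩ | ⟨hib, haj⟩)
    · exact Jrefl i
    · exact h
    · rcases hia with rfl | ⟨-, h, -⟩
      · rcases hbj with rfl | ⟨-, -, h⟩
        · exact Jab
        · exact Jtrans Jab h
      · exact absurd rfl h
    · rcases haj with rfl | ⟨h, -, -⟩
      · rcases hib with rfl | ⟨-, -, h⟩
        · exact Jsymm Jab
        · exact Jtrans h (Jsymm Jab)
      · exact absurd rfl h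
  · intro h
    by_cases hi : i = a
    · subst hi
      by_cases hj : j = i
      · exact Or.inl (Or.inl hj.symm)
      · exact Or.inr (Or.inl ⟨Or.inl rfl, Or.inr ⟨Ne.symm hab, hj, Jtrans (Jsymm Jab) h⟩⟩)
    · by_cases hj : j = a
      · subst hj
        refine Or.inr (Or.inr ⟨?_, Or.inl rfl⟩)
        by_cases hib : i = b
        · exact Or.inl hib
        · exact Or.inr ⟨hi, Ne.symm hab, Jtrans h Jab⟩
      · exact Or.inl (Or.inr ⟨hi, hj, h⟩)

/-- `e_k e_{k±1} e_k = e_k` (join / isolate / join): for `c ∈ {a, b}`, `a ≠ b`,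
`join a b ∘ isolate c ∘ join a b = join a b`. [cite: IkhlefPonsaing2012, §3.1] -/
theorem join_isolate_join {r : SiteRel n} (hr : r.IsNCEquiv) {a b c : Fin n} (hab : a ≠ b)
    (hc : c = a ∨ c = b) : ((r.join a b).isolate c).join a b = r.join a b := by
  rcases hc with rfl | rfl
  · exact join_isolate_left_join hr hab
  · rw [join_comm r a c, join_comm _ a c]
    exact join_isolate_left_join hr (Ne.symm hab)

/-- Any equivalence relation containing `S` and relating `a, b` contains `mergeRel S a b`. [folklore] -/
theorem mergeRel_le {V : Type*} {S T : V → V → Prop} (hT : Equivalence T)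
    (hST : ∀ x y, S x y → T x y) {a b : V} (hab : T a b) (x y : V) (h : mergeRel S a b x y) : T x y := by
  rcases h with h | ⟨h1, h2⟩ | ⟨h1, h2⟩
  · exact hST _ _ h
  · exact hT.trans (hST _ _ h1) (hT.trans hab (hST _ _ h2))
  · exact hT.trans (hST _ _ h1) (hT.trans (hT.symm hab) (hST _ _ h2))

/-- Far commutation: joins commute (both orders give the least equivalence relation containing `r`
and the two pairs). [cite: IkhlefPonsaing2012, §3.1] -/
theorem join_join_comm {r : SiteRel n} (hr : r.IsNCEquiv) (a b c d : Fin n) :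
    (r.join a b).join c d = (r.join c d).join a b := by
  have hS := hr.equivalence
  -- both sides as `Prop` relations
  have key : ∀ (a b c d : Fin n) (x y : Fin n),
      mergeRel (mergeRel (fun i j => r i j = true) a b) c d x y →
        mergeRel (mergeRel (fun i j => r i j = true) c d) a b x y := by
    intro a b c d
    have hcd := mergeRel_equivalence hS c d
    have hT := mergeRel_equivalence hcd a b
    refine mergeRel_le hT (fun x y h => ?_) (mergeRel_of_rel (mergeRel_self hS c d))
    exact mergeRel_le hT (fun x y h => mergeRel_of_rel (mergeRel_of_rel h)) (mergeRel_self hcd a b) x y h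
  have hiff : ∀ (a b c d : Fin n) (x y : Fin n),
      (r.join a b).join c d x y = true ↔ mergeRel (mergeRel (fun i j => r i j = true) a b) c d x y := by
    intro a b c d x y
    rw [join_eq_true_iff_mergeRel]
    have : (fun i j => r.join a b i j = true) = mergeRel (fun i j => r i j = true) a b := by
      funext i j; exact propext (join_eq_true_iff_mergeRel r a b i j)
    rw [this]
  funext x y
  rw [Bool.eq_iff_iff, hiff, hiff]
  exact ⟨key a b c d x y, key c d a b x y⟩

/-- Far commutation: isolations commute. [cite: IkhlefPonsaing2012, §3.1] -/
theorem isolate_isolate_comm (r : SiteRel n) (a c : Fin n) :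
    (r.isolate a).isolate c = (r.isolate c).isolate a := by
  funext i j
  rw [Bool.eq_iff_iff]
  simp only [isolate_eq_true_iff]
  tauto

/-- Far commutation: an isolation commutes with a join not involving the isolated site (for a
reflexive relation). [cite: IkhlefPonsaing2012, §3.1] -/
theorem isolate_join_comm {r : SiteRel n} (hrefl : ∀ i, r i i = true) {a b c : Fin n} (hca : c ≠ a)
    (hcb : c ≠ b) : (r.join a b).isolate c = (r.isolate c).join a b := by
  funext i j
  rw [Bool.eq_iff_iff]
  simp only [isolate_eq_true_iff, join_eq_true_iff]
  constructor
  · rintro (rfl | ⟨hi, hj, h | ⟨h1, h2⟩ | ⟨h1, h2⟩⟩)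
    · exact Or.inl (Or.inl rfl)
    · exact Or.inl (Or.inr ⟨hi, hj, h⟩)
    · exact Or.inr (Or.inl ⟨Or.inr ⟨hi, Ne.symm hca, h1⟩, Or.inr ⟨Ne.symm hcb, hj, h2⟩⟩)
    · exact Or.inr (Or.inr ⟨Or.inr ⟨hi, Ne.symm hcb, h1⟩, Or.inr ⟨Ne.symm hca, hj, h2⟩⟩)
  · rintro ((rfl | ⟨hi, hj, h⟩) | ⟨hia, hbj⟩ | ⟨hib, haj⟩)
    · exact Or.inl rfl
    · exact Or.inr ⟨hi, hj, Or.inl h⟩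
    · obtain ⟨hi, ria⟩ : i ≠ c ∧ r i a = true := by
        rcases hia with rfl | ⟨hi, -, h⟩
        · exact ⟨Ne.symm hca, hrefl _⟩
        · exact ⟨hi, h⟩
      obtain ⟨hj, rbj⟩ : j ≠ c ∧ r b j = true := by
        rcases hbj with rfl | ⟨-, hj, h⟩
        · exact ⟨Ne.symm hcb, hrefl _⟩
        · exact ⟨hj, h⟩
      exact Or.inr ⟨hi, hj, Or.inr (Or.inl ⟨ria, rbj⟩)⟩
    · obtain ⟨hi, rib⟩ : i ≠ c ∧ r i b = true := by
        rcases hib with rfl | ⟨hi, -, h⟩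
        · exact ⟨Ne.symm hcb, hrefl _⟩
        · exact ⟨hi, h⟩
      obtain ⟨hj, raj⟩ : j ≠ c ∧ r a j = true := by
        rcases haj with rfl | ⟨-, hj, h⟩
        · exact ⟨Ne.symm hca, hrefl _⟩
        · exact ⟨hj, h⟩
      exact Or.inr ⟨hi, hj, Or.inr (Or.inr ⟨rib, raj⟩)⟩

end SiteRel

/-! ### The finite state space and the Temperley–Lieb family -/

/-- **The states**: non-crossing equivalence relations on `Fin n` (cluster connectivities of the
boundary sites; `C_n` of them). [cite: IkhlefPonsaing2012, §3.1] -/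
def NCState (n : ℕ) : Type := {r : SiteRel n // r.IsNCEquiv}

/-- There are finitely many non-crossing states. [folklore] -/
instance : Fintype (NCState n) := Subtype.fintype _

/-- Equality of non-crossing states is decidable. [folklore] -/
instance : DecidableEq (NCState n) := Subtype.instDecidableEq

namespace NCState

/-- Join two consecutive sites. [cite: IkhlefPonsaing2012, §3.1] -/
def joinS (a b : Fin n) (hab : (b : ℕ) = a + 1) (s : NCState n) : NCState n :=
  ⟨s.1.join a b, s.2.join a b hab⟩

/-- Isolate a site. [cite: IkhlefPonsaing2012, §3.1] -/
def isolS (a : Fin n) (s : NCState n) : NCState n :=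
  ⟨s.1.isolate a, s.2.isolate a⟩

/-- The underlying relation of a joined state. [folklore] -/
@[simp] theorem joinS_val (a b : Fin n) (hab : (b : ℕ) = a + 1) (s : NCState n) :
    (joinS a b hab s).1 = s.1.join a b := rfl

/-- The underlying relation of an isolated state. [folklore] -/
@[simp] theorem isolS_val (a : Fin n) (s : NCState n) : (isolS a s).1 = s.1.isolate a := rfl

end NCState

section Family

variable (m : ℕ)

/-- The site index `⌊k/2⌋ : Fin m` of the generator `k : Fin (2m)`. [folklore] -/
def halfIdx (k : Fin (2 * m)) : Fin m := ⟨(k : ℕ) / 2, by omega⟩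

/-- **The generator maps** on states: `k = 2b ↦ join b (b+1)` (the generator `e_{2b+1}` of
`TL_{2m+1}`, across the dual site at level `2b+1`), `k = 2b+1 ↦ isolate (b+1)` (the generator
`e_{2b+2}`, across the site `b+1`); the bottom site `0` (the wall) is never isolated.
[cite: IkhlefPonsaing2012, §3.1] -/
def tlConnFun (k : Fin (2 * m)) : NCState (m + 1) → NCState (m + 1) :=
  if (k : ℕ) % 2 = 0 then
    NCState.joinS (Fin.castSucc (halfIdx m k)) (halfIdx m k).succ (by simp)
  else NCState.isolS (halfIdx m k).succ

/-- Even generators join. [folklore] -/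
theorem tlConnFun_of_even {k : Fin (2 * m)} (hk : (k : ℕ) % 2 = 0) :
    tlConnFun m k = NCState.joinS (Fin.castSucc (halfIdx m k)) (halfIdx m k).succ (by simp) := by
  simp [tlConnFun, hk]

/-- Odd generators isolate. [folklore] -/
theorem tlConnFun_of_odd {k : Fin (2 * m)} (hk : (k : ℕ) % 2 = 1) :
    tlConnFun m k = NCState.isolS (halfIdx m k).succ := by
  simp [tlConnFun, hk]

/-- `e² = e` for the generator maps. [cite: IkhlefPonsaing2012, §3.1] -/
theorem tlConnFun_idem (k : Fin (2 * m)) : tlConnFun m k ∘ tlConnFun m k = tlConnFun m k := by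
  funext s
  rcases Nat.mod_two_eq_zero_or_one k with hk | hk
  · rw [tlConnFun_of_even m hk]
    exact Subtype.ext (SiteRel.join_join s.2 _ _)
  · rw [tlConnFun_of_odd m hk]
    exact Subtype.ext (SiteRel.isolate_isolate s.1 _)

/-- `e_j e_{j+1} e_j = e_j` for the generator maps. [cite: IkhlefPonsaing2012, §3.1] -/
theorem tlConnFun_cubic_succ (j k : Fin (2 * m)) (hjk : (k : ℕ) = j + 1) :
    tlConnFun m j ∘ tlConnFun m k ∘ tlConnFun m j = tlConnFun m j := by
  funext s
  rcases Nat.mod_two_eq_zero_or_one j with hj | hj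
  · have hk : (k : ℕ) % 2 = 1 := by omega
    have hh : halfIdx m k = halfIdx m j := Fin.ext (by simp [halfIdx]; omega)
    rw [tlConnFun_of_even m hj, tlConnFun_of_odd m hk, hh]
    refine Subtype.ext ?_
    simp only [Function.comp_apply, NCState.joinS_val, NCState.isolS_val]
    exact SiteRel.join_isolate_join s.2 (Fin.castSucc_lt_succ (i := halfIdx m j)).ne (Or.inr rfl)
  · have hk : (k : ℕ) % 2 = 0 := by omega
    have hh : Fin.castSucc (halfIdx m k) = (halfIdx m j).succ :=
      Fin.ext (by simp [halfIdx]; omega)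
    rw [tlConnFun_of_odd m hj, tlConnFun_of_even m hk]
    refine Subtype.ext ?_
    simp only [Function.comp_apply, NCState.joinS_val, NCState.isolS_val, hh]
    exact SiteRel.isolate_join_isolate _ (Or.inl rfl)

/-- `e_{j+1} e_j e_{j+1} = e_{j+1}` for the generator maps. [cite: IkhlefPonsaing2012, §3.1] -/
theorem tlConnFun_cubic_pred (j k : Fin (2 * m)) (hjk : (k : ℕ) = j + 1) :
    tlConnFun m k ∘ tlConnFun m j ∘ tlConnFun m k = tlConnFun m k := by
  funext s
  rcases Nat.mod_two_eq_zero_or_one j with hj | hj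
  · have hk : (k : ℕ) % 2 = 1 := by omega
    have hh : halfIdx m k = halfIdx m j := Fin.ext (by simp [halfIdx]; omega)
    rw [tlConnFun_of_even m hj, tlConnFun_of_odd m hk, hh]
    refine Subtype.ext ?_
    simp only [Function.comp_apply, NCState.joinS_val, NCState.isolS_val]
    exact SiteRel.isolate_join_isolate _ (Or.inr rfl)
  · have hk : (k : ℕ) % 2 = 0 := by omega
    have hh : Fin.castSucc (halfIdx m k) = (halfIdx m j).succ :=
      Fin.ext (by simp [halfIdx]; omega)
    rw [tlConnFun_of_odd m hj, tlConnFun_of_even m hk]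
    refine Subtype.ext ?_
    simp only [Function.comp_apply, NCState.joinS_val, NCState.isolS_val, hh]
    exact SiteRel.join_isolate_join s.2 (by rw [← hh]; exact (Fin.castSucc_lt_succ (i := halfIdx m k)).ne)
      (Or.inl rfl)

/-- Far commutation for the generator maps. [cite: IkhlefPonsaing2012, §3.1] -/
theorem tlConnFun_comm (i j : Fin (2 * m)) (hij : (j : ℕ) + 1 < i) :
    tlConnFun m i ∘ tlConnFun m j = tlConnFun m j ∘ tlConnFun m i := by
  funext s
  rcases Nat.mod_two_eq_zero_or_one i with hi | hi <;>
    rcases Nat.mod_two_eq_zero_or_one j with hj | hj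
  · rw [tlConnFun_of_even m hi, tlConnFun_of_even m hj]
    exact Subtype.ext (SiteRel.join_join_comm s.2 _ _ _ _)
  · rw [tlConnFun_of_even m hi, tlConnFun_of_odd m hj]
    refine Subtype.ext ?_
    simp only [Function.comp_apply, NCState.joinS_val, NCState.isolS_val]
    refine (SiteRel.isolate_join_comm s.2.refl ?_ ?_).symm
    · intro h; have := congrArg Fin.val h; simp [halfIdx] at this; omega
    · intro h; have := congrArg Fin.val h; simp [halfIdx] at this; omega
  · rw [tlConnFun_of_odd m hi, tlConnFun_of_even m hj]
    refine Subtype.ext ?_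
    simp only [Function.comp_apply, NCState.joinS_val, NCState.isolS_val]
    refine SiteRel.isolate_join_comm s.2.refl ?_ ?_
    · intro h; have := congrArg Fin.val h; simp [halfIdx] at this; omega
    · intro h; have := congrArg Fin.val h; simp [halfIdx] at this; omega
  · rw [tlConnFun_of_odd m hi, tlConnFun_of_odd m hj]
    exact Subtype.ext (SiteRel.isolate_isolate_comm s.1 _ _)

variable (K : Type*) [CommRing K]

/-- **The Temperley–Lieb generators on the connectivity basis**: the linearisations of the generator
maps on the free module `NCState (m+1) →₀ K` (`0/1` matrices: loop weight `1`).
[cite: IkhlefPonsaing2012, §3.1] -/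
noncomputable def tlConn (k : Fin (2 * m)) : Module.End K (NCState (m + 1) →₀ K) :=
  Finsupp.lmapDomain K K (tlConnFun m k)

/-- Products of linearised maps are linearisations of composites. [folklore] -/
theorem lmapDomain_mul_lmapDomain {α : Type*} (f g : α → α) :
    (Finsupp.lmapDomain K K f : Module.End K (α →₀ K)) * Finsupp.lmapDomain K K g =
      Finsupp.lmapDomain K K (f ∘ g) := by
  rw [Module.End.mul_eq_comp, Finsupp.lmapDomain_comp]

/-- **The connectivity basis carries a Temperley–Lieb representation with loop weight `1`**
(`e_k² = e_k`, `e_k e_{k±1} e_k = e_k`, far commutation). [cite: IkhlefPonsaing2012, §3.1] -/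
theorem isTemperleyLiebFamily_tlConn : IsTemperleyLiebFamily (1 : K) (tlConn m K) := by
  refine ⟨fun j => ?_, fun j k hjk => ?_, fun j k hjk => ?_, fun i j hij => ?_⟩
  · rw [one_smul, tlConn, lmapDomain_mul_lmapDomain, tlConnFun_idem]
  · rw [tlConn, tlConn, lmapDomain_mul_lmapDomain, lmapDomain_mul_lmapDomain, Function.comp_assoc,
      tlConnFun_cubic_succ m j k hjk]
  · rw [tlConn, tlConn, lmapDomain_mul_lmapDomain, lmapDomain_mul_lmapDomain, Function.comp_assoc,
      tlConnFun_cubic_pred m j k hjk]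
  · rw [tlConn, tlConn, lmapDomain_mul_lmapDomain, lmapDomain_mul_lmapDomain, tlConnFun_comm m i j hij]

end Family

/-! ### The states are the lumped even-column patterns of the percolation dictionary -/

section Dictionary

variable (m : ℕ)

/-- **The state space of the percolation dictionary is the connectivity basis**: the lump-fixed
valid planar patterns at an even column (on which the lumped stationary law `ipStationaryL m` of
`DiagonalStripLumping.lean` lives) are in bijection with the non-crossing equivalence relations on
the `m + 1` column sites (forget the flags; they are the class of the bottom site `0`).
[cite: IkhlefPonsaing2012, §3.1] -/
def ncStateEquiv :
    {P : ColPattern m // IsValid 0 P ∧ IsPlanar P ∧ lump P = P} ≃ NCState (m + 1) where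
  toFun P := ⟨P.1.1, ⟨P.2.1.refl, P.2.1.symm, P.2.1.trans, P.2.2.1.noncross⟩⟩
  invFun s := ⟨(s.1, fun i => s.1 0 i),
    isValid_isPlanar_lump_of_noncross 0 s.2.refl s.2.symm s.2.trans s.2.noncross fun _ => rfl⟩
  left_inv P := by
    refine Subtype.ext (Prod.ext rfl (funext fun i => ?_))
    exact (snd_eq_fst_zero_of_lump_eq (by decide) P.2.1 P.2.2.2 i).symm
  right_inv s := rfl

/-- The dictionary equivalence forgets the flags. [folklore] -/
@[simp] theorem ncStateEquiv_apply_val (P : {P : ColPattern m // IsValid 0 P ∧ IsPlanar P ∧ lump P = P}) :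
    (ncStateEquiv m P).1 = P.1.1 := rfl

/-- The inverse keeps the relation. [folklore] -/
@[simp] theorem ncStateEquiv_symm_apply_fst (s : NCState (m + 1)) :
    ((ncStateEquiv m).symm s).1.1 = s.1 := rfl

/-- The inverse's flags are the class of the bottom site. [folklore] -/
theorem ncStateEquiv_symm_apply_snd (s : NCState (m + 1)) (i : Fin (m + 1)) :
    ((ncStateEquiv m).symm s).1.2 i = s.1 0 i := rfl

end Dictionary

/-! ### IP12 Lemma 3.1 on the connectivity basis -/

section YBE

variable (m : ℕ) {K : Type*} [Field K]

/-- At a primitive cube root of unity the loop weight `-(q + q⁻¹)` is `1`. [cite: IkhlefPonsaing2012, §2.4] -/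
theorem neg_add_inv_eq_one_of_cube {q : K} (hq : q ^ 2 + q + 1 = 0) : -(q + q⁻¹) = (1 : K) := by
  have hq0 : q ≠ 0 := by
    rintro rfl
    norm_num at hq
  field_simp
  linear_combination -hq

/-- **Yang–Baxter on the connectivity basis** (IP12 Lemma 3.1 for the representation of §3.1 in
the cluster language): for `q² + q + 1 = 0` and adjacent generators `k = j + 1`,
`Ř_j(u) Ř_k(uv) Ř_j(v) = Ř_k(v) Ř_j(uv) Ř_k(u)` with `Ř_i(w) = [q/w] - [w] e_i` (numerators).
[cite: IkhlefPonsaing2012, Lemma 3.1] -/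
theorem tlConn_yangBaxter {q : K} (hq : q ^ 2 + q + 1 = 0) {u v : K} (hu : u ≠ 0) (hv : v ≠ 0)
    (j k : Fin (2 * m)) (hjk : (k : ℕ) = j + 1) :
    tlRnum q u (tlConn m K j) * tlRnum q (u * v) (tlConn m K k) * tlRnum q v (tlConn m K j) =
      tlRnum q v (tlConn m K k) * tlRnum q (u * v) (tlConn m K j) * tlRnum q u (tlConn m K k) := by
  have hq0 : q ≠ 0 := by
    rintro rfl
    norm_num at hq
  have h1 := neg_add_inv_eq_one_of_cube hq
  have hF := isTemperleyLiebFamily_tlConn m K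
  refine tlRnum_yangBaxter hq0 hu hv ?_ ?_ (hF.cubic_succ j k hjk) (hF.cubic_pred j k hjk)
  · rw [h1]; exact hF.sq j
  · rw [h1]; exact hF.sq k

/-- The same with the roles of the two adjacent generators exchanged:
`Ř_k(u) Ř_j(uv) Ř_k(v) = Ř_j(v) Ř_k(uv) Ř_j(u)`, `k = j + 1`. [cite: IkhlefPonsaing2012, Lemma 3.1] -/
theorem tlConn_yangBaxter' {q : K} (hq : q ^ 2 + q + 1 = 0) {u v : K} (hu : u ≠ 0) (hv : v ≠ 0)
    (j k : Fin (2 * m)) (hjk : (k : ℕ) = j + 1) :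
    tlRnum q u (tlConn m K k) * tlRnum q (u * v) (tlConn m K j) * tlRnum q v (tlConn m K k) =
      tlRnum q v (tlConn m K j) * tlRnum q (u * v) (tlConn m K k) * tlRnum q u (tlConn m K j) := by
  have hq0 : q ≠ 0 := by
    rintro rfl
    norm_num at hq
  have h1 := neg_add_inv_eq_one_of_cube hq
  have hF := isTemperleyLiebFamily_tlConn m K
  refine tlRnum_yangBaxter hq0 hu hv ?_ ?_ (hF.cubic_pred j k hjk) (hF.cubic_succ j k hjk)
  · rw [h1]; exact hF.sq k
  · rw [h1]; exact hF.sq j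

/-- **Unitarity on the connectivity basis**: `Ř_k(w) Ř_k(1/w) = 1` (numerator form), `q² + q + 1 = 0`. [cite: IkhlefPonsaing2012, Lemma 3.1] -/
theorem tlConn_unitarity {q : K} (hq : q ^ 2 + q + 1 = 0) {w : K} (hw : w ≠ 0) (k : Fin (2 * m)) :
    tlRnum q w (tlConn m K k) * tlRnum q w⁻¹ (tlConn m K k) =
      algebraMap K _ (qbr (q / w) * qbr (q * w)) := by
  have hq0 : q ≠ 0 := by
    rintro rfl
    norm_num at hq
  have h1 := neg_add_inv_eq_one_of_cube hq
  refine tlRnum_unitarity hq0 hw ?_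
  rw [h1]; exact (isTemperleyLiebFamily_tlConn m K).sq k

/-- Distant `Ř`'s commute on the connectivity basis. [cite: IkhlefPonsaing2012, §3.2] -/
theorem tlConn_tlRnum_comm (q u v : K) (i j : Fin (2 * m)) (hij : (j : ℕ) + 1 < i) :
    tlRnum q u (tlConn m K i) * tlRnum q v (tlConn m K j) =
      tlRnum q v (tlConn m K j) * tlRnum q u (tlConn m K i) :=
  tlRnum_comm q u v ((isTemperleyLiebFamily_tlConn m K).comm i j hij)

end YBE

end Literature.Probability.LatticeModels.TemperleyLieb
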